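import Summits.ResolutionOfSingularities.ResolutionOfSingularities.Theorems.WeightedInvariantHypersurfaceLocalGameEFT4SDimLETwoOpen
import Summits.ResolutionOfSingularities.ResolutionOfSingularities.Theorems.WeightedInvariantContactCentreFiltrationRegular
import Summits.ResolutionOfSingularities.ResolutionOfSingularities.Theorems.WeightedInvariantHypersurfaceCentreAlgebraize
import Literature.AlgebraicGeometry.Resolution.QuadraticTransformsKeyLemma
import HarnessLib

/-!
# (open″)↾≤2 for `(iotaOrd, jContact)` — UNCONDITIONAL: the conjunct `JOpenPresentationForallSingLE2 p iotaOrd jContact`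
# of the P2 rung (door `HypersurfaceCentreConstruction`, stmt-ResolutionOfSingularities-19897; ORDER (o24-O), lead
# res-type-005, second hand res-type-025; res-L1-w43-plan-1 ASSIGNMENT 2026-08-27T08:16:45Z)

Topic: `Summits/ResolutionOfSingularities/ResolutionOfSingularities/Theorems`. Helper for the door item
`HypersurfaceCentreConstruction` (stmt-ResolutionOfSingularities-19897, route `WeightedInvariant`). The two hypotheses of the
assembly `GenericEquimultiplicity.jOpenPresentationForallSingLE2_iotaOrd_jContact_of` (`…EFT4SDimLETwoOpen`) are DISCHARGED
from res-type-092's (o24-D) REGULAR file (p516684): `hJmono` is `jContact_of_eq_unit_mul_pow` verbatim; `hcaseB` (a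
presentation of `jContact S f` at a position NOT of monomial type of a two-dimensional regular local ring essentially of finite
type over a field, by a positively weighted regular system of parameters with independent cotangent images) is
`one_le_bMax_and_reaches_of_essFiniteType` (termination of steepening: a parameter `g ∈ 𝔪 ∖ 𝔪²` reaching the terminal contact
level `b_max`) + the completion of `g` to a regular system of parameters `(x, g)` (exchange lemma, here) +
`weightedMonomialIdeal_eq_jContact` (the centre filtration is the `(x, g; 1, b_max)`-weighted filtration) + stub-9's
`linearIndependent_toCotangent_of_span_eq_of_spanFinrank_eq` (a minimal generating system has independent differentials).
[OURS · L1 W4.3 · (o24-O)] Replaces the role of NO printed item; NOT a statement of the manuscript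
[claim: Hironaka2017, status: under-review]. AI work, weaker than expert review.

## References

* V. Cossart, O. Piltant, J. Algebra 320 (2008), proof of Prop. 4.2. [cite: CossartPiltant2008, Prop. 4.2 (proof)]
* V. Cossart, U. Jannsen, S. Saito, LNM 2270 (2020), Ch. 8 (maximal contact in dimension two). [CossartJannsenSaito2020]
* H. Matsumura, Commutative Ring Theory (1987), Thm. 14.2–14.3. [Matsumura1987]
-/

noncomputable section

open IsLocalRing Literature.AlgebraicGeometry.Resolution
open Summit.ResolutionOfSingularities.ResolutionOfSingularities.Cruxes.HypersurfaceCentreConstruction.LocalEngine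

set_option linter.dupNamespace false -- mandated namespace of this single-conjunct summit

namespace Summit.ResolutionOfSingularities.ResolutionOfSingularities.Theorems

namespace GenericEquimultiplicity

/-- **Exchange**: if `𝔪 = (x, y)`, `g = a x + b y` with `a` a unit, then `𝔪 = (y, g)` (for `g ∈ 𝔪`). [folklore] -/
theorem span_pair_eq_maximalIdeal_of_isUnit {S : Type} [CommRing S] [IsLocalRing S] {x y a b g : S}
    (hy : y ∈ maximalIdeal S) (hg : g ∈ maximalIdeal S) (hm : maximalIdeal S = Ideal.span {x, y})
    (hab : a * x + b * y = g) (ha : IsUnit a) : Ideal.span {y, g} = maximalIdeal S := by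
  obtain ⟨ai, hai⟩ := ha.exists_left_inv
  apply le_antisymm
  · rw [Ideal.span_le]
    rintro z (rfl | rfl)
    exacts [hy, hg]
  · rw [hm, Ideal.span_le]
    rintro z (rfl | rfl)
    · have : z = ai * g - ai * b * y := by
        calc z = (ai * a) * z := by rw [hai, one_mul]
          _ = ai * g - ai * b * y := by rw [← hab]; ring
      rw [this]
      exact Ideal.sub_mem _ (Ideal.mul_mem_left _ _ (Ideal.subset_span (by simp)))
        (Ideal.mul_mem_left _ _ (Ideal.subset_span (by simp)))
    · exact Ideal.subset_span (by simp)

/-- **Completion of a regular parameter to a regular system of parameters** in a regular local ring of Krull dimension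
two: for `g ∈ 𝔪 ∖ 𝔪²` there is `x` with `𝔪 = (x, g)` (write `g = a x₀ + b y₀` in a regular system `(x₀, y₀)`; not both of
`a, b` lie in `𝔪` since `g ∉ 𝔪²`; exchange). [cite: Matsumura1987, Thm. 14.2] -/
theorem exists_span_pair_eq_maximalIdeal_of_not_mem_sq {S : Type} [CommRing S] [IsRegularLocalRing S]
    (hdim : ringKrullDim S = 2) {g : S} (hg : g ∈ maximalIdeal S) (hg2 : g ∉ maximalIdeal S ^ 2) :
    ∃ x ∈ maximalIdeal S, Ideal.span {x, g} = maximalIdeal S := by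
  obtain ⟨x₀, y₀, h𝔪, -⟩ := exists_maximalIdeal_eq_span_pair (R := S) hdim
  have hx₀ : x₀ ∈ maximalIdeal S := h𝔪 ▸ Ideal.subset_span (by simp)
  have hy₀ : y₀ ∈ maximalIdeal S := h𝔪 ▸ Ideal.subset_span (by simp)
  have hg' : g ∈ Ideal.span {x₀, y₀} := h𝔪 ▸ hg
  obtain ⟨a, b, hab⟩ := Ideal.mem_span_pair.mp hg'
  by_cases ha : IsUnit a
  · exact ⟨y₀, hy₀, span_pair_eq_maximalIdeal_of_isUnit hy₀ hg h𝔪 hab ha⟩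
  by_cases hb : IsUnit b
  · have h𝔪' : maximalIdeal S = Ideal.span {y₀, x₀} := by rw [h𝔪, Set.pair_comm]
    have hba : b * y₀ + a * x₀ = g := by rw [← hab]; ring
    exact ⟨x₀, hx₀, span_pair_eq_maximalIdeal_of_isUnit hx₀ hg h𝔪' hba hb⟩
  · exfalso
    apply hg2
    rw [← hab, pow_two]
    have ha' : a ∈ maximalIdeal S := by simpa [mem_maximalIdeal, mem_nonunits_iff] using ha
    have hb' : b ∈ maximalIdeal S := by simpa [mem_maximalIdeal, mem_nonunits_iff] using hb
    exact Ideal.add_mem _ (Ideal.mul_mem_mul ha' hx₀) (Ideal.mul_mem_mul hb' hy₀)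

/-- **Case B presentation of the centre filtration** at a position NOT of monomial type of a two-dimensional regular local
ring essentially of finite type over a field: `jContact S f = (x, g; 1, b_max)`-weighted filtration for a regular system of
parameters `(x, g)` with independent cotangent images, `g` a parameter reaching the terminal contact level `b_max ≥ 1`
(res-type-092's (o24-D): termination of steepening + identification of the centre filtration). This is the hypothesis `hcaseB`
of `jOpenPresentationForallSingLE2_iotaOrd_jContact_of`. [OURS · L1 W4.3 · (o24-O)] [cite: CossartJannsenSaito2020, Ch. 8] -/
theorem exists_presentation_jContact_of_not_isMonomialType (k₀ : Type) [Field k₀] (S : Type) [CommRing S]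
    [IsRegularLocalRing S] [Algebra k₀ S] [Algebra.EssFiniteType k₀ S] (hdim : ringKrullDim S = (2 : ℕ)) {f : S}
    (hf0 : f ≠ 0) (hf2 : f ∈ maximalIdeal S ^ 2) (hnm : ¬ IsMonomialType f) :
    ∃ (N : ℕ) (xy : Fin N → S) (W : Fin N → ℕ) (hxy : ∀ i, xy i ∈ maximalIdeal S), (∀ i, 0 < W i) ∧
      Ideal.span (Set.range xy) = maximalIdeal S ∧
      LinearIndependent (ResidueField S) (fun i => ((maximalIdeal S).toCotangent ⟨xy i, hxy i⟩ : CotangentSpace S)) ∧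
      ∀ m : ℕ, jContact S f m = weightedMonomialIdeal xy W m := by
  obtain ⟨hb, g, hg, hg2, hreach⟩ := one_le_bMax_and_reaches_of_essFiniteType k₀ S hf0 hf2 hnm
  have hdim' : ringKrullDim S = 2 := hdim
  obtain ⟨x, -, hxg⟩ := exists_span_pair_eq_maximalIdeal_of_not_mem_sq hdim' hg hg2
  have hrange : Set.range ![x, g] = {x, g} := by
    rw [Matrix.range_cons, Matrix.range_cons, Matrix.range_empty, Set.union_empty, Set.singleton_union]
  have hspan : Ideal.span (Set.range ![x, g]) = maximalIdeal S := by rw [hrange, hxg]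
  have hsf : (maximalIdeal S).spanFinrank = 2 := by
    have h := IsRegularLocalRing.spanFinrank_maximalIdeal (R := S)
    rw [hdim] at h
    exact_mod_cast h
  refine ⟨2, ![x, g], ![1, bMax f], fun i => hspan ▸ Ideal.subset_span ⟨i, rfl⟩, ?_, hspan,
    linearIndependent_toCotangent_of_span_eq_of_spanFinrank_eq _ hspan hsf,
    fun m => (weightedMonomialIdeal_eq_jContact S hf0 hnm hxg hg2 hb hreach m).symm⟩
  intro i
  fin_cases i
  · exact Nat.one_pos
  · exact hb

/-- **(open″)↾≤2 for `(iotaOrd, jContact)`** — the conjunct `JOpenPresentationForallSingLE2 p iotaOrd jContact` of the P2 rung of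
the door `HypersurfaceCentreConstruction`, unconditionally: the assembly `jOpenPresentationForallSingLE2_iotaOrd_jContact_of`
(monomial type: res-type-025's p515455; otherwise the case-(iii) engine p516179 with res-type-073's (strat)) with `hJmono :=`
res-type-092's `jContact_of_eq_unit_mul_pow` and `hcaseB := exists_presentation_jContact_of_not_isMonomialType`.
[OURS · L1 W4.3 · (o24-O) closed] [cite: CossartPiltant2008, Prop. 4.2 (proof)] -/
theorem jOpenPresentationForallSingLE2_iotaOrd_jContact (p : ℕ) : JOpenPresentationForallSingLE2 p iotaOrd jContact :=
  jOpenPresentationForallSingLE2_iotaOrd_jContact_of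
    (fun R _ _ _ _ _ hv hg hg2 hν m => jContact_of_eq_unit_mul_pow R hv hg hg2 hν m)
    (fun k₀ _ _ S _ _ _ _ hdim _ hf0 hf2 hnm => exists_presentation_jContact_of_not_isMonomialType k₀ S hdim hf0 hf2 hnm) p

end GenericEquimultiplicity

end Summit.ResolutionOfSingularities.ResolutionOfSingularities.Theorems

end
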